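import Mathlib

/-!
# The abstract multiplicative XOR lemma with hard-core measures (`stub_xor`)

Stub `stub_xor` of the line `Sketch` (card `multiplicative-xor-ladder`) of the crux
`Summit.QuantumAdvantage.QuantumAdvantage.Theses.MobiusLadder.LiouvilleOrthogonalTC0`
(stmt-QuantumAdvantage-1393).

For pieces `U_i` (`i : Fin k`), `[0,1]`-valued measures `M_i` of densities
`δ_i = (Σ_{U_i} M_i)/#U_i`, a `1`-bounded weight `lam` and a `1`-bounded test `g` on tuples such
that along every coordinate `i` and for every context `t` the `M_i`-weighted correlation
`|Σ_{u ∈ U_i} M_i(u) lam(u) g(t[i ↦ u])|` is at most `γ · #U_i`, one has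
`|Σ_{t ∈ ∏ U_i} (∏_i lam(t_i)) g(t)| ≤ (k γ + ∏_i (1 - δ_i)) ∏_i #U_i`.

This is Yao's XOR lemma proved from hard-core measures (Arora–Barak, Thm 19.2 from Lemma 19.3),
in the abstract form where the XOR is supplied by multiplicativity of `lam`.  The proof is the
textbook induction on `k`: split off coordinate `0` (`Fin.cons`), write
`lam(a) = M_0(a) lam(a) + (1 - M_0(a)) lam(a)`; the first part is controlled by the hard-core
hypothesis in coordinate `0` (uniformly in the remaining coordinates), the second part by the
induction hypothesis applied, for each fixed `a ∈ U_0`, to the test `r ↦ lam(a) g(a :: r)`, and the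
nonnegative weights `1 - M_0(a)` sum to `#U_0 (1 - δ_0)`.  Pure finite combinatorics over `ℝ`;
Mathlib only.
-/

set_option linter.dupNamespace false -- D-0017: single-problem summit ⇒ `QuantumAdvantage.QuantumAdvantage` by design

namespace Summit.QuantumAdvantage.QuantumAdvantage.Theorems.LiouvilleOrthogonalTC0

open Finset

/-- Splitting a sum over a box of `Fin (k+1)`-tuples along coordinate `0`:
`Σ_{t ∈ ∏_{i ≤ k} U_i} F(t) = Σ_{a ∈ U_0} Σ_{r ∈ ∏_{i < k} U_{i+1}} F(a :: r)`. -/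
private lemma sum_piFinset_succ {k : ℕ} (U : Fin (k + 1) → Finset ℕ)
    (F : (Fin (k + 1) → ℕ) → ℝ) :
    ∑ t ∈ Fintype.piFinset U, F t =
      ∑ a ∈ U 0, ∑ r ∈ Fintype.piFinset (fun i : Fin k => U i.succ),
        F (Fin.cons a r : Fin (k + 1) → ℕ) := by
  rw [← Finset.sum_product']
  refine Finset.sum_nbij' (fun t => (t 0, Fin.tail t))
    (fun p => (Fin.cons p.1 p.2 : Fin (k + 1) → ℕ)) ?_ ?_ ?_ ?_ ?_
  · intro t ht
    rw [Fintype.mem_piFinset] at ht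
    rw [Finset.mem_product, Fintype.mem_piFinset]
    exact ⟨ht 0, fun i => ht i.succ⟩
  · rintro ⟨a, r⟩ hp
    rw [Finset.mem_product, Fintype.mem_piFinset] at hp
    rw [Fintype.mem_piFinset]
    intro i
    refine Fin.cases ?_ (fun j => ?_) i
    · simpa using hp.1
    · simpa using hp.2 j
  · intro t _
    exact Fin.cons_self_tail t
  · rintro ⟨a, r⟩ _
    simp
  · intro t _
    simp only [Fin.cons_self_tail]

/-- **The abstract multiplicative XOR lemma with hard-core measures.** For pieces `U_i`,
`[0,1]`-valued measures `M_i` of densities `δ_i = (Σ_{U_i} M_i)/#U_i`, a `1`-bounded `lam` and a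
`1`-bounded test `g` on tuples such that along every coordinate `i` and for every context `t` the
`M_i`-weighted correlation `|Σ_{u ∈ U_i} M_i(u) lam(u) g(t[i ↦ u])|` is `≤ γ #U_i`, one has
`|Σ_{t ∈ ∏ U_i} (∏_i lam(t_i)) g(t)| ≤ (k γ + ∏_i (1 - δ_i)) ∏_i #U_i`
(induction on `k`, splitting `lam(u) = M_0(u) lam(u) + (1 - M_0(u)) lam(u)` in coordinate `0`;
Arora–Barak Thm 19.2 from Lemma 19.3, with the XOR supplied by multiplicativity). -/
theorem stub_xor (k : ℕ) (U : Fin k → Finset ℕ) (M : Fin k → ℕ → ℝ) (lam : ℕ → ℝ)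
    (g : (Fin k → ℕ) → ℝ) (γ : ℝ) (hγ : 0 ≤ γ)
    (hM : ∀ i u, 0 ≤ M i u ∧ M i u ≤ 1) (hlam : ∀ u, |lam u| ≤ 1) (hg : ∀ t, |g t| ≤ 1)
    (hcore : ∀ (i : Fin k) (t : Fin k → ℕ),
      |∑ u ∈ U i, M i u * lam u * g (Function.update t i u)| ≤ γ * #(U i)) :
    |∑ t ∈ Fintype.piFinset U, (∏ i, lam (t i)) * g t| ≤
      (k * γ + ∏ i, (1 - (∑ u ∈ U i, M i u) / #(U i))) * ∏ i, (#(U i) : ℝ) := by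
  induction k with
  | zero =>
    -- the box is the singleton `{Fin.elim0}`: `|g _| ≤ 1 = (0·γ + 1)·1`
    have hcard : #(Fintype.piFinset U) = 1 := by
      rw [Fintype.card_piFinset, Finset.univ_eq_empty, Finset.prod_empty]
    obtain ⟨t₀, ht₀⟩ := Finset.card_eq_one.1 hcard
    rw [ht₀, Finset.sum_singleton]
    simpa using hg t₀
  | succ k ih =>
    -- abbreviations for the `k` remaining coordinates
    set T : Finset (Fin k → ℕ) := Fintype.piFinset (fun i : Fin k => U i.succ) with hT
    set C' : ℝ := ∏ i : Fin k, (#(U i.succ) : ℝ) with hC'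
    set P' : ℝ := ∏ i : Fin k, (1 - (∑ u ∈ U i.succ, M i.succ u) / #(U i.succ)) with hP'
    set δ₀ : ℝ := (∑ u ∈ U 0, M 0 u) / #(U 0) with hδ₀
    have hC'nn : 0 ≤ C' := Finset.prod_nonneg fun i _ => Nat.cast_nonneg _
    have hδ₀nn : 0 ≤ δ₀ :=
      div_nonneg (Finset.sum_nonneg fun a _ => (hM 0 a).1) (Nat.cast_nonneg _)
    have hkγ : 0 ≤ (k : ℝ) * γ := mul_nonneg (Nat.cast_nonneg _) hγ
    have hTcard : (#T : ℝ) = C' := by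
      rw [hT, Fintype.card_piFinset, Nat.cast_prod]
    -- `|∏ lam(r i)| ≤ 1`
    have hL : ∀ r : Fin k → ℕ, |∏ i, lam (r i)| ≤ 1 := fun r => by
      rw [Finset.abs_prod]
      exact Finset.prod_le_one (fun i _ => abs_nonneg _) fun i _ => hlam _
    -- FIRST PART: the `M_0`-weighted piece, controlled by `hcore` in coordinate `0`
    have hS1 : |∑ r ∈ T, (∏ i, lam (r i)) *
        ∑ a ∈ U 0, M 0 a * lam a * g (Fin.cons a r : Fin (k + 1) → ℕ)| ≤ γ * #(U 0) * C' := by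
      calc |∑ r ∈ T, (∏ i, lam (r i)) *
              ∑ a ∈ U 0, M 0 a * lam a * g (Fin.cons a r : Fin (k + 1) → ℕ)|
          ≤ ∑ r ∈ T, |(∏ i, lam (r i)) *
              ∑ a ∈ U 0, M 0 a * lam a * g (Fin.cons a r : Fin (k + 1) → ℕ)| :=
            Finset.abs_sum_le_sum_abs _ _
        _ ≤ ∑ r ∈ T, γ * #(U 0) := by
            refine Finset.sum_le_sum fun r _ => ?_
            rw [abs_mul]
            have hc : |∑ a ∈ U 0, M 0 a * lam a * g (Fin.cons a r : Fin (k + 1) → ℕ)| ≤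
                γ * #(U 0) := by
              have h := hcore 0 (Fin.cons 0 r : Fin (k + 1) → ℕ)
              simpa only [Fin.update_cons_zero] using h
            calc |∏ i, lam (r i)| *
                  |∑ a ∈ U 0, M 0 a * lam a * g (Fin.cons a r : Fin (k + 1) → ℕ)|
                ≤ 1 * (γ * #(U 0)) := mul_le_mul (hL r) hc (abs_nonneg _) zero_le_one
              _ = γ * #(U 0) := one_mul _
        _ = γ * #(U 0) * C' := by
            rw [Finset.sum_const, nsmul_eq_mul, hTcard]
            ring
    -- SECOND PART: for each fixed `a ∈ U 0`, the induction hypothesis for the test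
    -- `r ↦ lam a * g (a :: r)` on the remaining `k` coordinates
    have hinner : ∀ a : ℕ, |∑ r ∈ T, (∏ i, lam (r i)) *
        (lam a * g (Fin.cons a r : Fin (k + 1) → ℕ))| ≤ (k * γ + P') * C' := by
      intro a
      have hg' : ∀ r : Fin k → ℕ, |lam a * g (Fin.cons a r : Fin (k + 1) → ℕ)| ≤ 1 := by
        intro r
        rw [abs_mul]
        exact mul_le_one₀ (hlam a) (abs_nonneg _) (hg _)
      have hcore' : ∀ (i : Fin k) (r : Fin k → ℕ),
          |∑ u ∈ U i.succ, M i.succ u * lam u *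
            (lam a * g (Fin.cons a (Function.update r i u) : Fin (k + 1) → ℕ))| ≤
            γ * #(U i.succ) := by
        intro i r
        have h := hcore i.succ (Fin.cons a r : Fin (k + 1) → ℕ)
        have heq : ∑ u ∈ U i.succ, M i.succ u * lam u *
            (lam a * g (Fin.cons a (Function.update r i u) : Fin (k + 1) → ℕ)) =
            lam a * ∑ u ∈ U i.succ, M i.succ u * lam u *
              g (Function.update (Fin.cons a r : Fin (k + 1) → ℕ) i.succ u) := by
          rw [Finset.mul_sum]
          refine Finset.sum_congr rfl fun u _ => ?_
          rw [Fin.cons_update]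
          ring
        rw [heq, abs_mul]
        calc |lam a| * |∑ u ∈ U i.succ, M i.succ u * lam u *
                g (Function.update (Fin.cons a r : Fin (k + 1) → ℕ) i.succ u)|
            ≤ 1 * (γ * #(U i.succ)) := mul_le_mul (hlam a) h (abs_nonneg _) zero_le_one
          _ = γ * #(U i.succ) := one_mul _
      exact ih (fun i => U i.succ) (fun i => M i.succ)
        (fun r => lam a * g (Fin.cons a r : Fin (k + 1) → ℕ)) (fun i u => hM i.succ u) hg' hcore'
    have hS2 : |∑ a ∈ U 0, (1 - M 0 a) * ∑ r ∈ T, (∏ i, lam (r i)) *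
        (lam a * g (Fin.cons a r : Fin (k + 1) → ℕ))| ≤
        ((#(U 0) : ℝ) - ∑ a ∈ U 0, M 0 a) * ((k * γ + P') * C') := by
      calc |∑ a ∈ U 0, (1 - M 0 a) * ∑ r ∈ T, (∏ i, lam (r i)) *
              (lam a * g (Fin.cons a r : Fin (k + 1) → ℕ))|
          ≤ ∑ a ∈ U 0, |(1 - M 0 a) * ∑ r ∈ T, (∏ i, lam (r i)) *
              (lam a * g (Fin.cons a r : Fin (k + 1) → ℕ))| := Finset.abs_sum_le_sum_abs _ _
        _ ≤ ∑ a ∈ U 0, (1 - M 0 a) * ((k * γ + P') * C') := by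
            refine Finset.sum_le_sum fun a _ => ?_
            have ha : 0 ≤ 1 - M 0 a := by linarith [(hM 0 a).2]
            rw [abs_mul, abs_of_nonneg ha]
            exact mul_le_mul_of_nonneg_left (hinner a) ha
        _ = ((#(U 0) : ℝ) - ∑ a ∈ U 0, M 0 a) * ((k * γ + P') * C') := by
            rw [← Finset.sum_mul, Finset.sum_sub_distrib, Finset.sum_const, nsmul_eq_mul, mul_one]
    -- the decomposition `lam a = M_0 a · lam a + (1 - M_0 a) · lam a`
    have hsplit : ∑ a ∈ U 0, ∑ r ∈ T,
        (lam a * ∏ i, lam (r i)) * g (Fin.cons a r : Fin (k + 1) → ℕ) =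
        (∑ r ∈ T, (∏ i, lam (r i)) *
          ∑ a ∈ U 0, M 0 a * lam a * g (Fin.cons a r : Fin (k + 1) → ℕ)) +
        ∑ a ∈ U 0, (1 - M 0 a) * ∑ r ∈ T, (∏ i, lam (r i)) *
          (lam a * g (Fin.cons a r : Fin (k + 1) → ℕ)) := by
      have h1 : (∑ r ∈ T, (∏ i, lam (r i)) *
          ∑ a ∈ U 0, M 0 a * lam a * g (Fin.cons a r : Fin (k + 1) → ℕ)) =
          ∑ a ∈ U 0, ∑ r ∈ T, (∏ i, lam (r i)) *
            (M 0 a * lam a * g (Fin.cons a r : Fin (k + 1) → ℕ)) := by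
        simp only [Finset.mul_sum]
        exact Finset.sum_comm
      rw [h1]
      simp only [Finset.mul_sum]
      rw [← Finset.sum_add_distrib]
      refine Finset.sum_congr rfl fun a _ => ?_
      rw [← Finset.sum_add_distrib]
      refine Finset.sum_congr rfl fun r _ => ?_
      ring
    -- the weights `1 - M_0 a` sum to `#U_0 (1 - δ₀)` (also when `U 0 = ∅`)
    have hweights : (#(U 0) : ℝ) - ∑ a ∈ U 0, M 0 a = #(U 0) * (1 - δ₀) := by
      rcases (U 0).eq_empty_or_nonempty with h0 | h0
      · simp [h0]
      · have hpos : (0 : ℝ) < #(U 0) := by exact_mod_cast h0.card_pos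
        rw [hδ₀]
        field_simp
    -- assemble
    rw [sum_piFinset_succ U]
    simp only [Fin.prod_univ_succ, Fin.cons_zero, Fin.cons_succ]
    rw [hsplit]
    push_cast
    have key : (((k : ℝ) + 1) * γ + (1 - δ₀) * P') * (#(U 0) * C') =
        (γ * #(U 0) * C' + #(U 0) * (1 - δ₀) * ((k * γ + P') * C')) +
          (#(U 0) * C') * (k * γ) * δ₀ := by
      ring
    have hextra : 0 ≤ (#(U 0) * C') * (k * γ) * δ₀ :=
      mul_nonneg (mul_nonneg (mul_nonneg (Nat.cast_nonneg _) hC'nn) hkγ) hδ₀nn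
    calc _ ≤ _ := abs_add_le _ _
      _ ≤ γ * #(U 0) * C' + ((#(U 0) : ℝ) - ∑ a ∈ U 0, M 0 a) * ((k * γ + P') * C') :=
          add_le_add hS1 hS2
      _ = γ * #(U 0) * C' + #(U 0) * (1 - δ₀) * ((k * γ + P') * C') := by rw [hweights]
      _ ≤ (((k : ℝ) + 1) * γ + (1 - δ₀) * P') * (#(U 0) * C') := by
          rw [key]
          linarith [hextra]

end Summit.QuantumAdvantage.QuantumAdvantage.Theorems.LiouvilleOrthogonalTC0
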